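/-
Copyright (c) 2026 the pub-hodgecm-mathlib formalisation cell (harness21).  Prover seat hodgecm-mathlib-B-p04 (g53): P6b wave B row QB3 (2-I)
«CHART COACTION, SCHEME → RING», PART 1∕2 «the coaction of a morphism `X ×_R G → X`» (DEALS v8, interim dealer desk F0P6d-plan (g8) «P6d-D1»
∕ heir desk F0P6b-plan (g14); LEAD F0P6-plan (g8) «M-152w» (1); box LA-ref2 (g7)), 2026-09-03.
-/
import Literature.AlgebraicGeometry.GroupSchemes.GroupSchemeKernelAlg
import Mathlib.AlgebraicGeometry.Morphisms.ClosedImmersion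
import HarnessLib

/-!
# The coaction `Γ(X) → Γ(X) ⊗_R Γ(G)` of a morphism `X ×_R G → X` of affine schemes, `G` an affine group scheme

Topic `AlgebraicGeometry/GroupSchemes`; namespace `Literature.AlgebraicGeometry.GroupSchemes.AffineGroupScheme` (= the namespace of ★ `Alg`,
`ptEquiv`, `Alg.comap`, `isoSpecOver`, `comap_mul_eq`).  DEFINITIONS (`algTensorHom`, `algTensorEquiv`, `coactionOf`) + theorems; no instance, no
notation, no named fact, no `sorry`.  Cell `pub/hodgecm-mathlib` (D-0151), P6b wave B, organ Q4 of the Q0 census `CENSUS-Q-junction.v1`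
(439a1fb80ba72eb2), PART 1 of 2 (PART 2 = ★ `AffineGroupSchemeActionCoaction`: the coaction of a Mathlib action `[ModObj G U]` and the heads in
the token shape of ★ sheet (A) `FiniteFlatGroupSchemeQuotientAffine`).  Lane `--supports stmt-HodgeConjecture-24832`; count-neutral.  HC_CM is
proved only modulo the printed citations (2 remaining named inputs hLiu418 = `stmt-HodgeConjecture-24832`, h413 = `stmt-HodgeConjecture-24833`)
until rung 0 closes; nothing here bears on it.

THE PRINT.  [MumfordAV1970] §12 (p. 111: the action of a finite group scheme `G = Spec` of a Hopf algebra on an affine `X = Spec A` «is given by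
a homomorphism of rings», the coaction, for which Thm. 1 is stated), [GortzWedhorn2020] Def. 4.44 (p. 117: an action is a morphism `G ×_S X → X`
that is a group action on `T`-valued points), [GortzWedhorn2023] §(27.2) (pp. 606–607: `Γ` of an affine group scheme is a Hopf algebra with
`m^* = Δ`, `e^* = ε`), [MumfordFogartyKirwan1994] Ch. 0 §3 Def. 0.8 (iv) (pp. 9–10: FREE iff `Ψ = (σ, p₂)` is a closed immersion).  For AFFINE
`X`, `G` over `R`, `C := Γ(X)`, `H := Γ(G)` (★ `Alg`; ★ `Alg.instHopfAlgebra` from the functorial group law when `[GrpObj G]`):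

* §1 **`algTensorEquiv X Y : Γ(X) ⊗_R Γ(Y) ≃ₐ[R] Γ(X ×_R Y)`** for affine `X`, `Y` (`a ⊗ b ↦ pr₁^*(a) · pr₂^*(b)`), by YONEDA: the points of
  `X ×_R Y` are the pairs of points (`ptEquiv_comp_algTensorHom`, `comp_algTensorHom_bijective`, `algTensorHom_bijective`).
* §2 the coaction **`coactionOf X G a : Γ(X) →ₐ[R] Γ(X) ⊗_R Γ(G)`** of ANY morphism `a : X ×_R G → X` (`:= algTensorEquiv⁻¹ ∘ a^*`), the
  dictionary `algTensorHom_comp_coactionOf` and the KEY point formula **`lift_comp_coactionOf`**: `(u ⊗ v) ∘ ρ_a` is the algebra map of the point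
  `a(x_u, g_v)`.
* §3 the LAWS from the point-wise laws of `a` (a RIGHT action: `x·1 = x`, `(x·g₁)·g₂ = x·(g₁g₂)`): **`coactionOf_counit`**, **`coactionOf_coassoc`**,
  in the ELEMENT-WISE token shape of ★ sheet (A) (`FiniteFlatGroupSchemeQuotientAffine.lean` :339–342: `TensorProduct.rid R C (TensorProduct.map
  LinearMap.id Coalgebra.counit (ρ c)) = c` and `TensorProduct.map LinearMap.id Coalgebra.comul (ρ c) = TensorProduct.assoc R C H H
  (TensorProduct.map ρ.toLinearMap LinearMap.id (ρ c))`) — decided on the universal points `(x₀, g₁, g₂)` of `X × G × G` through ★ `ptEquiv`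
  (`Δ ↦ g₁·g₂` by ★ `groupLaw_mul_apply` + ★ `CorepGroupLaw.mul_eq` + ★ `comulAlgHom_alg_eq`; `ε ↦ 1` by ★ `GroupSchemeKernelAlg.ptEquiv_one`).
* §4 FREENESS dictionary: the Galois map `c ⊗ c' ↦ (c ⊗ 1) · ρ_a(c')` is `Γ` of `(pr₁, a) : X × G → X × X` (`algTensorHom_comp_productMap_coactionOf`),
  hence onto iff `(pr₁, a)` is a closed immersion (**`surjective_productMap_coactionOf_iff`**; Mathlib `IsClosedImmersion.hasAffineProperty`).

Sheet (A)'s `hcoassoc` is the coaction of a RIGHT action; PART 2 explains how Mathlib's LEFT `ModObj` is read (commutative `G`, or `g ↦ g⁻¹`).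

## References
* [MumfordAV1970] D. Mumford, *Abelian Varieties* (1970), §12 «Quotients by finite group schemes», p. 111 and Thm. 1.
* [GortzWedhorn2020] U. Görtz, T. Wedhorn, *Algebraic Geometry I*, 2nd ed. (2020), (4.15) and Definition 4.44 (pp. 116–117).
* [GortzWedhorn2023] U. Görtz, T. Wedhorn, *Algebraic Geometry II* (2023), §(27.2), (27.2.1) (pp. 606–607).
* [MumfordFogartyKirwan1994] D. Mumford, J. Fogarty, F. Kirwan, *Geometric Invariant Theory*, 3rd ed. (1994), Ch. 0 §3, Def. 0.8 (pp. 9–10).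

## Design notes
* Points-first road (differs from the constant-group template ★ `RelativeSpec/EquivariantModuleInvariants`, which works with module invariants):
  every identity is an equality of `R`-algebra maps out of `Γ(X)`, decided on `T`-valued points through ★ `ptEquiv` ∕ ★ `ptEquiv_comp`; the
  tensor identification `Γ(X) ⊗ Γ(Y) ≅ Γ(X × Y)` is built by Yoneda from `lift ∕ fst ∕ snd`, not from `pullbackSpecIso`.
* `coactionOf` is parametric in the morphism `a` and in two POINT-WISE laws (the style of ★ `modObjOfPointwise`), so the commutative reading and the
  inverse-twisted reading of a Mathlib action (PART 2) are three-line instances.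
* Searches: `lean search` for `algTensorEquiv ∕ coactionOf ∕ pullbackSpecIso` under `Literature/AlgebraicGeometry/GroupSchemes` (∅; ★
  `AffineGroupSchemeBaseChangeAlg.algBaseChangeEquiv` is the base-change special case `Γ(G_{R′}) ≅ R′ ⊗ Γ(G)`, ★ `Motives/ProjectiveSpaceCells.specOverTensorIso`
  is the `Spec`-side statement over a field); Mathlib `Algebra.TensorProduct.lift ∕ productMap ∕ lift_comp_includeLeft ∕ lift_comp_includeRight'`,
  `IsClosedImmersion.of_surjective_of_isAffine ∕ isAffine_surjective_of_isAffine`.  Nothing is restated.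
-/

set_option autoImplicit false

-- Mathlib's `Over`/`Scheme` APIs are stated across semireducible wrappers (as in the ★ `GroupSchemes/*` files).
set_option backward.isDefEq.respectTransparency false

universe u

open CategoryTheory CategoryTheory.Limits AlgebraicGeometry MonoidalCategory CartesianMonoidalCategory TensorProduct

noncomputable section

namespace Literature.AlgebraicGeometry.GroupSchemes

namespace AffineGroupScheme

open scoped MonObj

open Literature.AlgebraicGeometry.Motives Literature.NumberTheory.DiophantineGeometry

variable {R : Type u} [CommRing R] (X G : SchemeOver R)

/-! ## §1 `Γ(X ×_R G) ≅ Γ(X) ⊗_R Γ(G)` for affine `X`, `G` -/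

/-- The canonical `R`-algebra map `Γ(X) ⊗_R Γ(G) → Γ(X ×_R G)`, `a ⊗ b ↦ pr₁^*(a) · pr₂^*(b)`. [cite: GortzWedhorn2020, Section (4.7), (4.7.1) (p. 108)] -/
def algTensorHom : Alg X ⊗[R] Alg G →ₐ[R] Alg (X ⊗ G) :=
  Algebra.TensorProduct.lift (Alg.comap (fst X G)) (Alg.comap (snd X G)) fun _ _ => .all _ _

/-- `algTensorHom (a ⊗ b) = pr₁^*(a) · pr₂^*(b)`. [cite: GortzWedhorn2020, Section (4.7), (4.7.1) (p. 108)] -/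
theorem algTensorHom_tmul (a : Alg X) (b : Alg G) :
    algTensorHom X G (a ⊗ₜ b) = Alg.comap (fst X G) a * Alg.comap (snd X G) b :=
  Algebra.TensorProduct.lift_tmul _ _ _ a b

variable [IsAffine X.left] [IsAffine G.left]

/-- `X ×_R G` is affine for affine `X`, `G` over `R` (Mathlib: pullback of affine schemes). [cite: GortzWedhorn2020, Section (4.7), (4.7.1) (p. 108)] -/
theorem isAffine_tensorObj_left' : IsAffine (X ⊗ G).left := by
  rw [Over.tensorObj_left]
  infer_instance

variable {T : Type u} [CommRing T] [Algebra R T]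

/-- Yoneda: the algebra map of a point `p : Spec T → X ×_R G`, pulled back along `algTensorHom`, is `lift` of the algebra maps of
its two components. [cite: GortzWedhorn2020, Section (4.7), (4.7.1) (p. 108)] -/
theorem ptEquiv_comp_algTensorHom (p : specOver R T ⟶ X ⊗ G) :
    haveI := isAffine_tensorObj_left' X G
    (ptEquiv (X ⊗ G) T p).comp (algTensorHom X G) =
      Algebra.TensorProduct.lift (ptEquiv X T (p ≫ fst X G)) (ptEquiv G T (p ≫ snd X G)) fun _ _ => .all _ _ := by
  haveI := isAffine_tensorObj_left' X G
  apply Algebra.TensorProduct.ext'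
  intro a b
  rw [AlgHom.comp_apply, algTensorHom_tmul, map_mul, Algebra.TensorProduct.lift_tmul, ptEquiv_comp, ptEquiv_comp,
    AlgHom.comp_apply, AlgHom.comp_apply]

/-- Yoneda: precomposition with `algTensorHom` is a bijection on `T`-valued algebra maps, for every commutative `R`-algebra `T`
(points of `X ×_R G` are pairs of points). [cite: GortzWedhorn2020, Section (4.7), (4.7.1) (p. 108)] -/
theorem comp_algTensorHom_bijective :
    haveI := isAffine_tensorObj_left' X G
    Function.Bijective fun φ : Alg (X ⊗ G) →ₐ[R] T => φ.comp (algTensorHom X G) := by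
  haveI := isAffine_tensorObj_left' X G
  constructor
  · intro φ₁ φ₂ h
    obtain ⟨p₁, rfl⟩ := (ptEquiv (X ⊗ G) T).surjective φ₁
    obtain ⟨p₂, rfl⟩ := (ptEquiv (X ⊗ G) T).surjective φ₂
    simp only [ptEquiv_comp_algTensorHom] at h
    have h1 := congrArg (fun ψ => AlgHom.comp ψ Algebra.TensorProduct.includeLeft) h
    have h2 := congrArg (fun ψ => AlgHom.comp ψ Algebra.TensorProduct.includeRight) h
    simp only [Algebra.TensorProduct.lift_comp_includeLeft, Algebra.TensorProduct.lift_comp_includeRight',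
      EmbeddingLike.apply_eq_iff_eq] at h1 h2
    congr 1
    exact CartesianMonoidalCategory.hom_ext _ _ h1 h2
  · intro ψ
    refine ⟨ptEquiv (X ⊗ G) T (lift ((ptEquiv X T).symm (ψ.comp Algebra.TensorProduct.includeLeft))
      ((ptEquiv G T).symm (ψ.comp Algebra.TensorProduct.includeRight))), ?_⟩
    simp only [ptEquiv_comp_algTensorHom, lift_fst, lift_snd, Equiv.apply_symm_apply]
    apply Algebra.TensorProduct.ext'
    intro x y
    rw [Algebra.TensorProduct.lift_tmul, AlgHom.comp_apply, AlgHom.comp_apply, ← map_mul,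
      Algebra.TensorProduct.includeLeft_apply, Algebra.TensorProduct.includeRight_apply, Algebra.TensorProduct.tmul_mul_tmul,
      mul_one, one_mul]

/-- `algTensorHom` is bijective (Yoneda: a map inducing bijections on all `Hom(-, T)` is an isomorphism). [cite: GortzWedhorn2020, Section (4.7), (4.7.1) (p. 108)] -/
theorem algTensorHom_bijective : Function.Bijective (algTensorHom X G) := by
  haveI := isAffine_tensorObj_left' X G
  obtain ⟨ψ, hψ⟩ := (comp_algTensorHom_bijective X G (T := Alg X ⊗[R] Alg G)).2 (AlgHom.id R _)
  replace hψ : ψ.comp (algTensorHom X G) = AlgHom.id R _ := hψ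
  have hψ' : (algTensorHom X G).comp ψ = AlgHom.id R _ := by
    apply (comp_algTensorHom_bijective X G (T := Alg (X ⊗ G))).1
    change ((algTensorHom X G).comp ψ).comp (algTensorHom X G) = (AlgHom.id R _).comp (algTensorHom X G)
    rw [AlgHom.comp_assoc, hψ, AlgHom.comp_id, AlgHom.id_comp]
  refine ⟨fun a b hab => ?_, fun c => ⟨ψ c, ?_⟩⟩
  · have := congrArg ψ hab
    rwa [← AlgHom.comp_apply, ← AlgHom.comp_apply, hψ] at this
  · rw [← AlgHom.comp_apply, hψ', AlgHom.id_apply]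

/-- **`Γ(X) ⊗_R Γ(G) ≃ₐ[R] Γ(X ×_R G)`** for affine `X`, `G` over `R` (`Spec A ×_R Spec B = Spec (A ⊗_R B)`). [cite: GortzWedhorn2020, Section (4.7), (4.7.1) (p. 108)] -/
def algTensorEquiv : Alg X ⊗[R] Alg G ≃ₐ[R] Alg (X ⊗ G) :=
  AlgEquiv.ofBijective (algTensorHom X G) (algTensorHom_bijective X G)

/-- `algTensorEquiv` is `algTensorHom` on elements. [cite: GortzWedhorn2020, Section (4.7), (4.7.1) (p. 108)] -/
theorem algTensorEquiv_apply (z : Alg X ⊗[R] Alg G) : algTensorEquiv X G z = algTensorHom X G z := rfl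

/-! ## §2 The coaction of a morphism `a : X ×_R G → X` -/

variable (a : X ⊗ G ⟶ X)

/-- The **coaction** `ρ_a := (Γ(X ×_R G) ≅ Γ(X) ⊗ Γ(G)) ∘ a^* : Γ(X) → Γ(X) ⊗_R Γ(G)` of a morphism `a : X ×_R G → X`
([MumfordAV1970] §12: the action on an affine scheme «is given by a homomorphism of rings»). [cite: MumfordAV1970, §12 Thm. 1 (p. 111)] -/
def coactionOf : Alg X →ₐ[R] Alg X ⊗[R] Alg G :=
  ((algTensorEquiv X G).symm : Alg (X ⊗ G) →ₐ[R] Alg X ⊗[R] Alg G).comp (Alg.comap a)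

/-- Dictionary: `algTensorHom ∘ ρ_a = a^*`. [cite: MumfordAV1970, §12 Thm. 1 (p. 111)] -/
theorem algTensorHom_comp_coactionOf : (algTensorHom X G).comp (coactionOf X G a) = Alg.comap a := by
  ext c
  change algTensorEquiv X G ((algTensorEquiv X G).symm (Alg.comap a c)) = Alg.comap a c
  rw [AlgEquiv.apply_symm_apply]

/-- **KEY (the coaction on points)**: for algebra maps `u : Γ(X) → T`, `v : Γ(G) → T` (= points `x`, `g`), `(u ⊗ v) ∘ ρ_a` is the
algebra map of the point `a(x, g)` (actions are read on `T`-valued points). [cite: GortzWedhorn2020, Definition 4.44, p. 117] -/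
theorem lift_comp_coactionOf (u : Alg X →ₐ[R] T) (v : Alg G →ₐ[R] T) :
    (Algebra.TensorProduct.lift u v fun _ _ => .all _ _).comp (coactionOf X G a) =
      ptEquiv X T (lift ((ptEquiv X T).symm u) ((ptEquiv G T).symm v) ≫ a) := by
  haveI := isAffine_tensorObj_left' X G
  have h := ptEquiv_comp_algTensorHom X G (T := T) (lift ((ptEquiv X T).symm u) ((ptEquiv G T).symm v))
  rw [lift_fst, lift_snd, Equiv.apply_symm_apply, Equiv.apply_symm_apply] at h
  rw [← h, ptEquiv_comp, AlgHom.comp_assoc, algTensorHom_comp_coactionOf]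


/-! ## §3 The two laws: counit and coassociativity from the point-wise laws of `a` -/

section Laws

variable [GrpObj G]

omit [IsAffine X.left] in
/-- The algebra map of a product point `g₁ * g₂ : Spec T → G` is `(g₁ ⊗ g₂) ∘ Δ` (★ `groupLaw_mul_apply`, ★ `CorepGroupLaw.mul_eq`,
★ `comulAlgHom_alg_eq`). [cite: GortzWedhorn2023, §(27.2) (27.2.1) (pp. 606–607)] -/
theorem ptEquiv_mul_eq (g₁ g₂ : specOver R T ⟶ G) :
    ptEquiv G T (g₁ * g₂) =
      (Algebra.TensorProduct.lift (ptEquiv G T g₁) (ptEquiv G T g₂) fun _ _ => .all _ _).comp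
        (Bialgebra.comulAlgHom R (Alg G)) := by
  rw [← groupLaw_mul_apply, CorepGroupLaw.mul_eq, comulAlgHom_alg_eq]

omit [IsAffine X.left] in
/-- `(id ⊗ ε)` followed by `C ⊗ R ≅ C` is the algebra map `lift id (η ∘ ε)` (checked on pure tensors). [folklore] -/
private theorem rid_map_counit_eq_lift (z : Alg X ⊗[R] Alg G) :
    TensorProduct.rid R (Alg X) (TensorProduct.map LinearMap.id (Coalgebra.counit (R := R) (A := Alg G)) z) =
      Algebra.TensorProduct.lift (AlgHom.id R (Alg X)) ((Algebra.ofId R (Alg X)).comp (Bialgebra.counitAlgHom R (Alg G)))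
        (fun _ _ => .all _ _) z := by
  induction z using TensorProduct.induction_on with
  | zero => simp only [map_zero]
  | tmul c h =>
      rw [TensorProduct.map_tmul, TensorProduct.rid_tmul, Algebra.TensorProduct.lift_tmul, LinearMap.id_apply, AlgHom.id_apply,
        AlgHom.comp_apply, Bialgebra.counitAlgHom_apply, Algebra.ofId_apply, Algebra.smul_def, mul_comm]
  | add x y hx hy => rw [map_add, map_add, map_add, hx, hy]

omit [IsAffine X.left] in
/-- `(id ⊗ Δ)` is the algebra map `lift includeLeft (includeRight ∘ Δ)` (checked on pure tensors). [folklore] -/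
private theorem map_id_comul_eq_lift (z : Alg X ⊗[R] Alg G) :
    TensorProduct.map LinearMap.id (Coalgebra.comul (R := R) (A := Alg G)) z =
      Algebra.TensorProduct.lift (Algebra.TensorProduct.includeLeft : Alg X →ₐ[R] Alg X ⊗[R] (Alg G ⊗[R] Alg G))
        ((Algebra.TensorProduct.includeRight : Alg G ⊗[R] Alg G →ₐ[R] Alg X ⊗[R] (Alg G ⊗[R] Alg G)).comp
          (Bialgebra.comulAlgHom R (Alg G))) (fun _ _ => .all _ _) z := by
  induction z using TensorProduct.induction_on with
  | zero => simp only [map_zero]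
  | tmul c h =>
      rw [TensorProduct.map_tmul, Algebra.TensorProduct.lift_tmul, LinearMap.id_apply, AlgHom.comp_apply,
        Bialgebra.comulAlgHom_apply, Algebra.TensorProduct.includeLeft_apply, Algebra.TensorProduct.includeRight_apply,
        Algebra.TensorProduct.tmul_mul_tmul, mul_one, one_mul]
  | add x y hx hy => rw [map_add, map_add, hx, hy]

omit [IsAffine X.left] [IsAffine G.left] [GrpObj G] in
/-- `assoc ((z) ⊗ h) = (lift includeLeft (includeRight ∘ includeLeft)) z · (1 ⊗ (1 ⊗ h))` (checked on pure tensors). [folklore] -/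
private theorem assoc_tmul_eq_lift_mul (z : Alg X ⊗[R] Alg G) (h : Alg G) :
    TensorProduct.assoc R (Alg X) (Alg G) (Alg G) (z ⊗ₜ h) =
      Algebra.TensorProduct.lift (Algebra.TensorProduct.includeLeft : Alg X →ₐ[R] Alg X ⊗[R] (Alg G ⊗[R] Alg G))
        ((Algebra.TensorProduct.includeRight : Alg G ⊗[R] Alg G →ₐ[R] Alg X ⊗[R] (Alg G ⊗[R] Alg G)).comp
          (Algebra.TensorProduct.includeLeft : Alg G →ₐ[R] Alg G ⊗[R] Alg G)) (fun _ _ => .all _ _) z *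
        ((1 : Alg X) ⊗ₜ ((1 : Alg G) ⊗ₜ h)) := by
  induction z using TensorProduct.induction_on with
  | zero => simp only [TensorProduct.zero_tmul, map_zero, zero_mul]
  | tmul c h' =>
      simp only [TensorProduct.assoc_tmul, Algebra.TensorProduct.lift_tmul, AlgHom.comp_apply,
        Algebra.TensorProduct.includeLeft_apply, Algebra.TensorProduct.includeRight_apply,
        Algebra.TensorProduct.tmul_mul_tmul, mul_one, one_mul]
  | add x y hx hy => rw [TensorProduct.add_tmul, map_add, map_add, add_mul, hx, hy]

omit [IsAffine X.left] [IsAffine G.left] [GrpObj G] in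
/-- `assoc ∘ (φ ⊗ id)` is the algebra map `lift ((lift includeLeft (includeRight ∘ includeLeft)) ∘ φ) (includeRight ∘ includeRight)`
(checked on pure tensors). [folklore] -/
private theorem assoc_map_eq_lift (φ : Alg X →ₐ[R] Alg X ⊗[R] Alg G) (z : Alg X ⊗[R] Alg G) :
    TensorProduct.assoc R (Alg X) (Alg G) (Alg G) (TensorProduct.map φ.toLinearMap LinearMap.id z) =
      Algebra.TensorProduct.lift
        ((Algebra.TensorProduct.lift (Algebra.TensorProduct.includeLeft : Alg X →ₐ[R] Alg X ⊗[R] (Alg G ⊗[R] Alg G))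
          ((Algebra.TensorProduct.includeRight : Alg G ⊗[R] Alg G →ₐ[R] Alg X ⊗[R] (Alg G ⊗[R] Alg G)).comp
            (Algebra.TensorProduct.includeLeft : Alg G →ₐ[R] Alg G ⊗[R] Alg G)) (fun _ _ => .all _ _)).comp φ)
        ((Algebra.TensorProduct.includeRight : Alg G ⊗[R] Alg G →ₐ[R] Alg X ⊗[R] (Alg G ⊗[R] Alg G)).comp
          (Algebra.TensorProduct.includeRight : Alg G →ₐ[R] Alg G ⊗[R] Alg G)) (fun _ _ => .all _ _) z := by
  induction z using TensorProduct.induction_on with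
  | zero => simp only [map_zero]
  | tmul c h =>
      rw [TensorProduct.map_tmul, LinearMap.id_apply, AlgHom.toLinearMap_apply, assoc_tmul_eq_lift_mul,
        Algebra.TensorProduct.lift_tmul, AlgHom.comp_apply, AlgHom.comp_apply, Algebra.TensorProduct.includeRight_apply,
        Algebra.TensorProduct.includeRight_apply]
  | add x y hx hy => rw [map_add, map_add, map_add, hx, hy]

/-- **Counit law**: if `a(x, 1) = x` on `T`-valued points, then `(id ⊗ ε) ∘ ρ_a = id` — in the element-wise shape of ★ sheet (A)
(`FiniteFlatGroupSchemeQuotientAffine.finite_faithfullyFlat_invariants`, hypothesis `hcounit`). [cite: MumfordAV1970, §12 Thm. 1 (p. 111)] -/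
theorem coactionOf_counit (hone : ∀ ⦃W : SchemeOver R⦄ (x : W ⟶ X), lift x (1 : W ⟶ G) ≫ a = x) (c : Alg X) :
    TensorProduct.rid R (Alg X) (TensorProduct.map LinearMap.id (Coalgebra.counit (R := R) (A := Alg G)) (coactionOf X G a c)) = c := by
  rw [rid_map_counit_eq_lift, ← AlgHom.comp_apply, lift_comp_coactionOf, ← ptEquiv_one, Equiv.symm_apply_apply, hone,
    Equiv.apply_symm_apply, AlgHom.id_apply]

/-- **Coassociativity law**: if `a(a(x, g₁), g₂) = a(x, g₁ g₂)` on `T`-valued points (a RIGHT action), then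
`(id ⊗ Δ) ∘ ρ_a = assoc ∘ (ρ_a ⊗ id) ∘ ρ_a` — in the element-wise shape of ★ sheet (A) (hypothesis `hcoassoc`). [cite: MumfordAV1970, §12 Thm. 1 (p. 111)] -/
theorem coactionOf_coassoc
    (hmul : ∀ ⦃W : SchemeOver R⦄ (x : W ⟶ X) (g₁ g₂ : W ⟶ G), lift (lift x g₁ ≫ a) g₂ ≫ a = lift x (g₁ * g₂) ≫ a) (c : Alg X) :
    TensorProduct.map LinearMap.id (Coalgebra.comul (R := R) (A := Alg G)) (coactionOf X G a c) =
      TensorProduct.assoc R (Alg X) (Alg G) (Alg G) (TensorProduct.map (coactionOf X G a).toLinearMap LinearMap.id (coactionOf X G a c)) := by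
  rw [map_id_comul_eq_lift, assoc_map_eq_lift, ← AlgHom.comp_apply, ← AlgHom.comp_apply, lift_comp_coactionOf, lift_comp_coactionOf,
    lift_comp_coactionOf, Equiv.symm_apply_apply, hmul]
  congr 4
  apply (ptEquiv G _).injective
  rw [Equiv.apply_symm_apply, ptEquiv_mul_eq, Equiv.apply_symm_apply, Equiv.apply_symm_apply]
  congr 1
  apply Algebra.TensorProduct.ext'
  intro h₁ h₂
  simp only [Algebra.TensorProduct.lift_tmul, AlgHom.comp_apply, Algebra.TensorProduct.includeLeft_apply,
    Algebra.TensorProduct.includeRight_apply, Algebra.TensorProduct.tmul_mul_tmul, mul_one, one_mul]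

end Laws


/-! ## §4 Freeness: the Galois map is `Γ` of `(pr₁, a) : X × G → X × X` -/

section Free

/-- **The Galois map is `Γ(pr₁, a)`**: `(Γ(X ×_R G) ≅ Γ(X) ⊗ Γ(G))⁻¹`-conjugate of the Galois map `c ⊗ c' ↦ (c ⊗ 1) · ρ_a(c')` is the pull-back
along `(pr₁, a) : X ×_R G → X ×_R X`. [cite: MumfordFogartyKirwan1994, Ch. 0 §3, Def. 0.8 (pp. 9–10)] -/
theorem algTensorHom_comp_productMap_coactionOf :
    (algTensorHom X G).comp (Algebra.TensorProduct.productMap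
        (Algebra.TensorProduct.includeLeft : Alg X →ₐ[R] Alg X ⊗[R] Alg G) (coactionOf X G a)) =
      (Alg.comap (lift (fst X G) a)).comp (algTensorHom X X) := by
  apply Algebra.TensorProduct.ext'
  intro c c'
  rw [AlgHom.comp_apply, AlgHom.comp_apply, Algebra.TensorProduct.productMap_apply_tmul, map_mul,
    Algebra.TensorProduct.includeLeft_apply, algTensorHom_tmul, map_one, mul_one, ← AlgHom.comp_apply (algTensorHom X G),
    algTensorHom_comp_coactionOf, algTensorHom_tmul, map_mul, ← AlgHom.comp_apply, ← AlgHom.comp_apply (Alg.comap _),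
    ← Alg.comap_comp, ← Alg.comap_comp, lift_fst, lift_snd]

/-- **Freeness dictionary**: the Galois map `C ⊗ C → C ⊗ H` of `ρ_a` is onto iff `(pr₁, a) : X ×_R G → X ×_R X` is a closed immersion
(affine schemes: closed immersion ⟺ surjective on global sections, Mathlib `IsClosedImmersion.hasAffineProperty`).
[cite: MumfordFogartyKirwan1994, Ch. 0 §3, Def. 0.8 (iv) (pp. 9–10)] -/
theorem surjective_productMap_coactionOf_iff :
    Function.Surjective (Algebra.TensorProduct.productMap
        (Algebra.TensorProduct.includeLeft : Alg X →ₐ[R] Alg X ⊗[R] Alg G) (coactionOf X G a)) ↔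
      IsClosedImmersion (lift (fst X G) a).left := by
  haveI := isAffine_tensorObj_left' X G
  haveI := isAffine_tensorObj_left' X X
  have key : ∀ z, algTensorHom X G (Algebra.TensorProduct.productMap
      (Algebra.TensorProduct.includeLeft : Alg X →ₐ[R] Alg X ⊗[R] Alg G) (coactionOf X G a) z) =
      (lift (fst X G) a).left.appTop.hom (algTensorHom X X z) := fun z => by
    rw [← AlgHom.comp_apply, algTensorHom_comp_productMap_coactionOf]; rfl
  have hiff : Function.Surjective (Algebra.TensorProduct.productMap
      (Algebra.TensorProduct.includeLeft : Alg X →ₐ[R] Alg X ⊗[R] Alg G) (coactionOf X G a)) ↔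
      Function.Surjective (lift (fst X G) a).left.appTop := by
    constructor
    · intro h y
      obtain ⟨z, hz⟩ := h ((algTensorEquiv X G).symm y)
      refine ⟨algTensorHom X X z, ?_⟩
      rw [← key, hz]
      exact (algTensorEquiv X G).apply_symm_apply y
    · intro h w
      obtain ⟨y, hy⟩ := h (algTensorHom X G w)
      obtain ⟨z, rfl⟩ := (algTensorHom_bijective X X).2 y
      refine ⟨z, (algTensorHom_bijective X G).1 ?_⟩
      rw [key, hy]
  rw [hiff]
  constructor
  · intro h
    exact IsClosedImmersion.of_surjective_of_isAffine _ h
  · intro h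
    exact (IsClosedImmersion.isAffine_surjective_of_isAffine (f := (lift (fst X G) a).left)).2

end Free

end AffineGroupScheme

end Literature.AlgebraicGeometry.GroupSchemes

end
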